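import Summits.NavierStokesRegularity.NavierStokesRegularity.Theses.TerminalTrace
import Literature.Analysis.FluidPDE.NSQuasipotential
import Summits.NavierStokesRegularity.NavierStokesRegularity.Theorems.AdaptedKernelExists.Negative.ViscosityLoadBearing

/-!
# `NoTraceConcentration` is false without its Leray–Hopf hypothesis

Negative-side support for the crux `NoTraceConcentration` (stmt-NavierStokesRegularity-18381, route
`TerminalTrace`), refuter crux-attack at birth (2026-08-17). Theorems only (no definitions).

The crux reads the terminal state `u T` ONLY through the Leray–Hopf hypothesis
`IsLerayHopfOn T ν 0 (u 0) u` (weak `L²` continuity on `(0, T]` pins `u T` a.e. as the weak limit of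
the classical slices `u t`, `t ↑ T`; `memLp` makes it square integrable). The classical hypothesis
lives on `[0, T)` and the decay hypothesis on the datum `u 0`, so with the Leray–Hopf clause deleted
the slice `u T` is a free function and the statement is false
(`noTraceConcentration_false_without_lerayHopf`): take the rest state on `[0, 1)` and put the
`|x|⁻¹` scar `x ↦ ‖x‖⁻¹ e₀` at time `1`; its scaled energy `r⁻¹ ∫_{B(0,r)} ‖x‖⁻² dx = 4π` does not
tend to `0` (only the lower bound `≥ 4π/3`, from `‖x‖⁻² ≥ r⁻²` on the ball, is used).

Information for provers: any proof of the crux must extract `u T` from `weak_continuous` / `memLp`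
of `IsLerayHopfOn` (as `SereginSverak2002.setIntegral_ball_norm_sq_final_le_of_bound` does); the
`|x|⁻¹` profile is the model scar of constant positive scaled energy that the crux has to exclude at
a first-time singular point (`scaledEnergy_inv_norm_sq_ge`).
-/

noncomputable section

namespace Summit.NavierStokesRegularity.NavierStokesRegularity.Theorems.NoTraceConcentration.Negative

open MeasureTheory Filter Set Metric Real
open Literature.Analysis.FluidPDE

/-- `‖x‖⁻²` is integrable on every ball about the origin of `ℝ³` (polar coordinates, Mathlib
`integrableOn_fun_norm_addHaar`: `y² · y⁻² = 1` on `(0, r)`). [folklore] -/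
theorem integrableOn_inv_norm_sq (r : ℝ) :
    IntegrableOn (fun x : EuclideanSpace ℝ (Fin 3) => (‖x‖ ^ 2)⁻¹)
      (ball (0 : EuclideanSpace ℝ (Fin 3)) r) volume := by
  have key : IntegrableOn
      (fun y : ℝ => y ^ (Module.finrank ℝ (EuclideanSpace ℝ (Fin 3)) - 1) • (fun y : ℝ => (y ^ 2)⁻¹) y)
      (Ioo 0 r) volume := by
    rw [finrank_euclideanSpace_fin]
    refine (integrableOn_const (C := (1 : ℝ)) (measure_Ioo_lt_top).ne).congr_fun ?_ measurableSet_Ioo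
    intro y hy
    have hy0 : y ≠ 0 := hy.1.ne'
    simp only [smul_eq_mul]
    field_simp
  exact (integrableOn_fun_norm_addHaar (μ := (volume : Measure (EuclideanSpace ℝ (Fin 3))))
    (f := fun y : ℝ => (y ^ 2)⁻¹) (r := r)).2 key

/-- **The `|x|⁻¹` scar has scaled energy bounded below**: `4π/3 ≤ r⁻¹ ∫_{B(0,r)} ‖x‖⁻² dx` for
every `r > 0` (the exact value is `4π`; compare `‖x‖⁻² ≥ r⁻²` on the ball, `|B(0,r)| = 4πr³/3`). [folklore] -/
theorem scaledEnergy_inv_norm_sq_ge {r : ℝ} (hr : 0 < r) :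
    π * 4 / 3 ≤ r⁻¹ * ∫ x in ball (0 : EuclideanSpace ℝ (Fin 3)) r, (‖x‖ ^ 2)⁻¹ := by
  have hvol : volume.real (ball (0 : EuclideanSpace ℝ (Fin 3)) r) = r ^ 3 * (π * 4 / 3) := by
    rw [measureReal_def, EuclideanSpace.volume_ball_fin_three, ENNReal.toReal_mul,
      ← ENNReal.ofReal_pow hr.le, ENNReal.toReal_ofReal (pow_nonneg hr.le 3),
      ENNReal.toReal_ofReal (by positivity)]
  have hfin : volume (ball (0 : EuclideanSpace ℝ (Fin 3)) r) ≠ ⊤ := measure_ball_lt_top.ne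
  have hconst : ∫ _ in ball (0 : EuclideanSpace ℝ (Fin 3)) r, (r ^ 2)⁻¹ =
      (r ^ 2)⁻¹ * (r ^ 3 * (π * 4 / 3)) := by
    rw [setIntegral_const, hvol, smul_eq_mul, mul_comm]
  have h0 : ∀ᵐ x ∂(volume : Measure (EuclideanSpace ℝ (Fin 3))), x ≠ 0 := by
    have : ({(0 : EuclideanSpace ℝ (Fin 3))}ᶜ : Set (EuclideanSpace ℝ (Fin 3))) ∈
        ae (volume : Measure (EuclideanSpace ℝ (Fin 3))) :=
      compl_mem_ae_iff.2 (measure_singleton 0)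
    filter_upwards [this] with x hx
    simpa using hx
  have hmono : ∫ _ in ball (0 : EuclideanSpace ℝ (Fin 3)) r, (r ^ 2)⁻¹ ≤
      ∫ x in ball (0 : EuclideanSpace ℝ (Fin 3)) r, (‖x‖ ^ 2)⁻¹ := by
    refine setIntegral_mono_on_ae (integrableOn_const hfin) (integrableOn_inv_norm_sq r)
      measurableSet_ball ?_
    filter_upwards [h0] with x hx hxr
    rw [mem_ball_zero_iff] at hxr
    have hxpos : 0 < ‖x‖ := norm_pos_iff.2 hx
    gcongr
  calc π * 4 / 3 = r⁻¹ * ((r ^ 2)⁻¹ * (r ^ 3 * (π * 4 / 3))) := by field_simp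
    _ = r⁻¹ * ∫ _ in ball (0 : EuclideanSpace ℝ (Fin 3)) r, (r ^ 2)⁻¹ := by rw [hconst]
    _ ≤ r⁻¹ * ∫ x in ball (0 : EuclideanSpace ℝ (Fin 3)) r, (‖x‖ ^ 2)⁻¹ :=
        mul_le_mul_of_nonneg_left hmono (inv_nonneg.2 hr.le)

/-- A field that is the rest state at every time of `[0, T)` is a classical solution (zero pressure,
zero force) on `[0, T)`, WHATEVER its slice at `T`: every clause of `IsClassicalNSSolutionOn` only
sees the slices `u t`, `t ∈ [0, T)`, and the time derivative within `[0, T)`. [folklore] -/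
theorem isClassicalNSSolutionOn_of_eq_zero_on_Ico {T : ℝ}
    {u : ℝ → EuclideanSpace ℝ (Fin 3) → EuclideanSpace ℝ (Fin 3)}
    (huv : ∀ t ∈ Ico (0 : ℝ) T, u t = 0) (ν : ℝ) :
    IsClassicalNSSolutionOn (Ico 0 T) ν 0 u 0 := by
  have h := isClassicalNSSolutionOn_zero (E := EuclideanSpace ℝ (Fin 3)) (Ico (0 : ℝ) T) ν
  have huv' : ∀ t ∈ Ico (0 : ℝ) T,
      u t = (0 : ℝ → EuclideanSpace ℝ (Fin 3) → EuclideanSpace ℝ (Fin 3)) t := fun t ht => by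
    rw [huv t ht]; rfl
  exact
    { smooth_velocity :=
        h.smooth_velocity.congr fun z hz => by
          change u z.1 z.2 = (0 : ℝ → EuclideanSpace ℝ (Fin 3) → EuclideanSpace ℝ (Fin 3)) z.1 z.2
          rw [huv' z.1 (mem_prod.1 hz).1]
      smooth_pressure := h.smooth_pressure
      momentum := fun t ht x => by
        have h1 : timeDerivWithin (Ico 0 T) u t x = timeDerivWithin (Ico 0 T)
            (0 : ℝ → EuclideanSpace ℝ (Fin 3) → EuclideanSpace ℝ (Fin 3)) t x := by
          simp only [timeDerivWithin]
          exact derivWithin_congr (fun s hs => by rw [huv' s hs]) (by rw [huv' t ht])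
        rw [h1, huv' t ht]
        exact h.momentum t ht x
      divFree := fun t ht => by
        rw [huv' t ht]
        exact h.divFree t ht }

/-- **`NoTraceConcentration` with the Leray–Hopf hypothesis deleted is false**: the classical
hypothesis on `[0, T)` and the decay of the datum do not constrain the slice `u T`. Witness
`ν = T = 1`, `u t = 0` for `t < 1`, `u 1 = (x ↦ ‖x‖⁻¹ e₀)`, `p = 0`, `x₀ = 0`: the scaled energy is
`≥ 4π/3` at every radius. Any proof of the crux must therefore read `u T` off `IsLerayHopfOn`
(weak `L²` continuity at `T`). [folklore] -/
theorem noTraceConcentration_false_without_lerayHopf :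
    ¬ (∀ (ν T : ℝ), 0 < ν → 0 < T →
        ∀ (u : ℝ → EuclideanSpace ℝ (Fin 3) → EuclideanSpace ℝ (Fin 3))
          (p : ℝ → EuclideanSpace ℝ (Fin 3) → ℝ),
        IsClassicalNSSolutionOn (Set.Ico 0 T) ν 0 u p → HasRapidSpatialDecay (u 0) →
        ∀ x₀ : EuclideanSpace ℝ (Fin 3),
          Tendsto (fun r : ℝ => r⁻¹ * ∫ x in Metric.ball x₀ r, ‖u T x‖ ^ 2)
            (nhdsWithin 0 (Set.Ioi 0)) (nhds 0)) := by
  intro h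
  set w : EuclideanSpace ℝ (Fin 3) → EuclideanSpace ℝ (Fin 3) :=
    fun x => ‖x‖⁻¹ • EuclideanSpace.single (0 : Fin 3) (1 : ℝ) with hw
  have hnorm : ∀ x : EuclideanSpace ℝ (Fin 3), ‖w x‖ ^ 2 = (‖x‖ ^ 2)⁻¹ := fun x => by
    simp [hw, norm_smul, inv_pow]
  set u : ℝ → EuclideanSpace ℝ (Fin 3) → EuclideanSpace ℝ (Fin 3) :=
    fun t x => if t < 1 then 0 else w x with hu
  have hrest : ∀ t ∈ Ico (0 : ℝ) 1, u t = 0 := fun t ht => by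
    funext x; simp [hu, ht.2]
  have hdec : HasRapidSpatialDecay (u 0) := by
    rw [hrest 0 ⟨le_rfl, one_pos⟩]
    exact AdaptedKernelExistsNegative.hasRapidSpatialDecay_zero
  have hone : u 1 = w := by funext x; simp [hu]
  have ht := h 1 1 one_pos one_pos u 0 (isClassicalNSSolutionOn_of_eq_zero_on_Ico hrest 1) hdec 0
  simp only [hone, hnorm] at ht
  have hge : ∀ᶠ r in nhdsWithin (0 : ℝ) (Ioi 0),
      π * 4 / 3 ≤ r⁻¹ * ∫ x in ball (0 : EuclideanSpace ℝ (Fin 3)) r, (‖x‖ ^ 2)⁻¹ :=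
    eventually_nhdsWithin_of_forall fun r hr => scaledEnergy_inv_norm_sq_ge hr
  have hle : π * 4 / 3 ≤ (0 : ℝ) := ge_of_tendsto ht hge
  linarith [Real.pi_pos]

end Summit.NavierStokesRegularity.NavierStokesRegularity.Theorems.NoTraceConcentration.Negative
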